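import Summits.AtomisticToContinuum.Crystallization.Theses.PalmUnimodularRigidity
import Summits.AtomisticToContinuum.Crystallization.Theorems.LayeredLawsSelectHcp.Negative.RootedRedundant
import Summits.AtomisticToContinuum.Crystallization.Theorems.LayeredLawsSelectHcp.Negative.FccModel
import Summits.AtomisticToContinuum.Crystallization.Theorems.LayeredLawsSelectHcp.Negative.IntendedModel
import Summits.AtomisticToContinuum.Crystallization.Theorems.ExcessDecayLiouvilleCoarseGrainsHcpEnergySeries
import Summits.AtomisticToContinuum.Crystallization.Theorems.PalmUnimodularRigidityCruxesToPalmRigidity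
import Summits.AtomisticToContinuum.Crystallization.Theorems.PalmUnimodularRigidityLayeredLawsSelectHcpDefs
import Summits.AtomisticToContinuum.Crystallization.Theorems.PalmUnimodularRigidityLayeredLawsSelectHcpRelaxedReference
import Summits.AtomisticToContinuum.Crystallization.Theorems.PalmUnimodularRigidityLayeredLawsSelectHcpTubeMuGSC
import Summits.AtomisticToContinuum.Crystallization.Theorems.PalmUnimodularRigidityLayeredLawsSelectHcpLocalCongruence
import Summits.AtomisticToContinuum.Crystallization.Theorems.ReggeStarCoercivityDefectFreeCrystallizesPalmDefs
import Summits.AtomisticToContinuum.Crystallization.Theorems.ReggeStarCoercivityDefectFreeCrystallizesRouteBetaFloor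
import Summits.AtomisticToContinuum.Crystallization.Theorems.ReggeStarCoercivityDefectFreeCrystallizesDefectVersion
import Summits.AtomisticToContinuum.Crystallization.Theorems.ReggeStarCoercivityDefectFreeCrystallizesAnnulusCount
import Summits.AtomisticToContinuum.Crystallization.Theorems.ReggeStarCoercivityDefectFreeCrystallizesFunnelOfLayered
import Summits.AtomisticToContinuum.Crystallization.Theorems.ReggeStarCoercivityDefectFreeCrystallizesRouteBetaTubeMerge
import Literature.Probability.Process.PointStationaryLaw

/-!
# Line `one-floor-exact-stars` — checked ALTERNATIVE skeleton for crux `LayeredLawsSelectHcp`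
(item stmt-AtomisticToContinuum-9226, route `PalmUnimodularRigidity`, rank 3) — crux-strategist s2 (2026-08-17)

This is an ALTERNATIVE line; it does NOT replace the lead's registered skeleton
`Lines/mtp_prestress_split_ergodic_frame.lean` (open stubs `stub_selectionFloor`, `stub_finiteCertificate`).

Crux (by name; `Negative.DiracLaws.crux_iff` is `Iff.rfl`): for every `δ > 0` and every probability law `P` on rooted
configurations of `ℝ³` that is (H1) a.s. `count|S`, `0 ∈ S`, `δ`-separated, (H2) point-stationary (Mecke), (H3) minimising
`E_P[h] ≤ e*`, (H4) a.s. LAYERED (every point `(1/100)`-good at a scale in `[9/10,1]`, `S` bond-isomorphic to an ideal Barlow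
stacking of SOME Hägg word), `P`-a.s. the sample is `count|A(hcpStacking a h)` with `e(hcp a h) = e*` (`IsRelaxedHcp`).

## THE LINE (lens: transfer from the sibling crux 13603 `ReggeStarCoercivity.DefectFreeCrystallizes`, its strategist line
## `Cruxes/DefectFreeCrystallizes/Lines/exact_star_shortcut.lean`, run THE OTHER WAY)

ONE FLOOR, THEN EXACT GEOMETRY.  Every registered line of this crux funnels into two e*-free analytic cores: robust Hägg SELECTION in
the 1 % tube (`stub_selectionFloor`, XL, unattended) and hcp-chart RIGIDITY (`stub_hcpTubeRigidity` ⇐ `stub_finiteCertificate`, XL, live).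
Both re-derive EXACTNESS of the sample from minimality, each with its own certificate, and the selection core must in addition fight
RELAXATION ROBUSTNESS (cut forces of faulted references, word-uniform frame-free coercivity — STRATEGY-CENSUS s1 §T2).  This line
replaces the pair by ONE law-level statement that is locally WORD-BLIND and already registered, staffed and partly landed on the sibling
crux 13603 (lead c8, skeleton `palm_good_law.lean` v29): the ROBUST FUNNEL FLOOR
  X1 `stub_funnelDefectFloor`:  `hcpE a₀ h₀ + κ · E_P[Dm] ≤ E_P[h]`
for every point-stationary rooted hard-core law a.s. carried by everywhere-`SetGood` Barlow-charted FORCE-BALANCED configurations with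
ZERO MEAN VIRIAL STRESS, where `Dm` is any measurable version of `D = min(starDefect a₀ h₀, fccDefect a₀) + #annulus(11/10, 5/4]` —
the squared congruence defect of the root star against the NEARER of the two exact reference stars (relaxed-hcp anticuboctahedron
`refStar a₀ h₀`, regular cuboctahedron `a₀ • fccKissingPattern`).  Because `D` tolerates BOTH star types, X1 contains no stacking
selection beyond the affine/laminar level (Hägg domination at fixed geometry, certified: Disproof §23, `SiteColumnLJ` p141765) and
its κ is the phonon scale (Bloch truth `λ_D = 0.263`, lead c2/c3 of THIS crux), not the letter price `7e-5`.
For a MINIMISING layered law the hypotheses of X1 are LANDED consequences of (H2)–(H4): hard core `891/1000`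
(`ae_isRootedHardCore_of_layered`), a.s. force balance and zero mean virial stress (`RouteBetaFloor.ae_forceBalance_of_minimising`,
`zeroMeanStress_of_minimising`, p136476 over p135765/p136018 and this crux's μGSC theorems p114799), tube ⊂ funnel
(`FunnelOfLayered.stub_funnelOfLayered`, p149307: `GoodShell`+`BarlowLike` ⇒ `SetGood` + chart with window `6/5`).  Then the sandwich
`hcpE ≤ hcpE + κE_P[Dm] ≤ E_P[h] ≤ e* ≤ hcpE` (H3, `iInf_le_hcpE`) forces `E_P[Dm] = 0`: ALMOST SURELY THE ROOT STAR IS EXACT (one of the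
two types, annulus empty) — at EVERY point by the landed Aldous–Lyons lemma `ae_forall_map_sub_of_ae` — AND `hcpE a₀ h₀ = e*`.
What is left is TOLERANCE-ZERO:
  X2 `stub_exactStarRigidity` (M/L, pure geometry): everywhere-exact two-type stars on a `SetGood` funnel-charted set ⇒ an EXACT
     rotated Barlow stacking `A '' barlowStacking a₀ h s'`, `h ∈ {h₀, a₀√(2/3)}` (hcp-word case LANDED: `stub_localCongruence` p102411);
  X3 `stub_exactSelectionLaw` (M, bookkeeping over LANDED energetics): a point-stationary law a.s. carried by such exact stackings with
     `E_P[h] ≤ hcpE a₀ h₀` is a.s. `count|A(hcpStacking a₀ h₀)` — the site-energy column `SiteColumnLJ.stub_siteColumnLJ` (p141765,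
     `J₃ − J₂ > 0` certified on the box) + `tube_hcpE_unique_minimiser` (p116871) + Aldous–Lyons.
All three stubs are VERBATIM (name and signature) the stubs of 13603's line `exact-star-shortcut` (X1 = lead c8's registered CORE;
X2, X3 `stub-add`ed on 13603 by its strategist gen 2): ONE proof of each closes the stub on BOTH cruxes.

  `layeredRigidity_of_stubs : X1 → X2 → X3 → (∀ P, prob → PointStationary → E_P[h] ≤ e* → Layered → a.s. IsRelaxedHcp)` — sorry-free;
  `LayeredLawsSelectHcp_of : LayeredLawsSelectHcp` — the crux BY NAME from the three `stub_*` through `crux_iff`.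
Sorries live ONLY in the three `stub_*`.  H1/δ unused (`crux_iff_without_rooted`, Disproof §13).

WHY IT DODGES THE STUCK GOALS OF THE LIVE LINE.  (i) `stub_selectionFloor` (XL, nobody on it; its difficulty is relaxation robustness of
Hägg selection in the 1 % tube) DISAPPEARS: selection is done at EXACT geometry by X3 over the landed column — no Young/slaving, no cut
forces, no word-uniform frame.  (ii) `stub_finiteCertificate` (XL; lead c3: far-field range control, 456²–1761² LMI, enclosure transfer)
is replaced by X1, whose architecture on 13603 (lead c8, E0–E6: expand every bond at the LAW'S OWN MEAN squared length so the first order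
vanishes identically; laminar-affine floor with modulus = finite-dimensional certified; fluctuation positivity word-uniform) is frame-free
BY CONSTRUCTION and is where this crux's hcp Bloch/LMI numerics (λ_D, taxes, kit j019182/j023116) are consumed anyway.  (iii) the merge is
already half in the tree: `RouteBetaTubeMerge.starDefect_ae_zero_of_funnelDefectFloor` (lead c8) proves X1 ⇒ the live line's rigidity core
(`stub_hcpTubeRigidity`, e*-form) — restated below as `hcpTubeRigidity_eStar_of_core`; this file adds the SELECTION half: X1 makes it exact.
Honest price: X1 is a STRONGER statement than the crux needs (κ-form, all words, the 1/20-funnel class ⊋ the 1 % tube); the bet — shared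
with 13603 and 14993 — is that one robust floor is cheaper to certify ONCE than two tube cores with two architectures.

## Disproof.lean obligations honoured (tree `Cruxes/LayeredLawsSelectHcp/Disproof.lean`; landed `Theorems/LayeredLawsSelectHcp/Negative/*`)
* `layeredLawsSelectHcp_false_without_energy` (H3 load-bearing; witness `fccLaw`): H3 is used TWICE — to put the law in X1's class (force
  balance, zero mean stress are derived from `E_P[h] ≤ e*`) and in the sandwich; X3 carries the level `E_P[h] ≤ hcpE a₀ h₀`.  The fcc Palm
  law at its own relaxed scale is in X1's class with `D ≈ 12(a_fcc − a₀)² > 0`-or-`0` and is priced only at `hcpE ≤ e_fcc` (certified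
  `+7.185e-5`, Disproof §23) — X1 does not conclude hcp, X2 allows fcc (`h = a₀√(2/3)`), only X3 (with the level) excludes it.
* `crux_iff_without_rooted` (§13): H1/δ unused.  `not_pointStationaryPlus_hcpPalm` (Mecke sign): every stub quantifies the `−y` identity
  (`IsPointStationaryLaw` = `PointStationary` verbatim).  `HcpNotBravais` / `IntendedModel.hcpStacking_sub_b_eq_neg`: `∃ A` linear kept.
* Threshold window §21: X1/X3 use the level `hcpE a₀ h₀ < e_fcc − 7.185e-5`, inside the decided window.
* No stub is an instance of a landed Negative lemma: X1 concludes an INEQUALITY with the energy on the right, X2 has no energy and allows both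
  letters, X3 keeps the energy hypothesis (cf. `cubicRootNull_false_without_energy`).  `ledger negatives` (Crystallization): 4146 / 3506 are
  finite-configuration statements outside the class.
-/

noncomputable section

open scoped BigOperators ENNReal
open Filter Topology MeasureTheory Set

namespace Summit.AtomisticToContinuum.Crystallization.Cruxes.LayeredLawsSelectHcp.OneFloorExactStars

open Literature.MathematicalPhysics.StatisticalMechanics Literature.Geometry.DiscreteGeometry
open Literature.Probability.Process
open Summit.AtomisticToContinuum.Crystallization.Theses.PalmUnimodularRigidity (LayeredLawsSelectHcp)
open Summit.AtomisticToContinuum.Crystallization.Theorems.ChargedEnergyGapNegative (eStar eStar_le)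
open Summit.AtomisticToContinuum.Crystallization.Theorems.LayeredLawsSelectHcp.Negative.DiracLaws
  (Rooted PointStationary meanRootEnergy GoodShell BarlowLike Layered IsRelaxedHcp crux_iff)
open Summit.AtomisticToContinuum.Crystallization.Theorems.LayeredLawsSelectHcp.Negative.FccModel
  (set_eq_of_count_restrict_eq)
open Summit.AtomisticToContinuum.Crystallization.Theorems.PalmGoodLaw (SetGood)
open Summit.AtomisticToContinuum.Crystallization.Theorems.PalmUnimodularRigidity
  (ae_forall_map_sub_of_ae count_restrict_floorNorm_preimage_lt_top)
open Summit.AtomisticToContinuum.Crystallization.Theorems.PalmUnimodularRigidity.LayeredLawsSelectHcp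
  (hcpE hcpQ hcpSite hcpStarIdx refStar rootStar starDefect starDefect_nonneg stub_relaxedReference HcpCharted HcpLayered
    ae_isRootedHardCore_of_layered stub_localCongruence)
open Summit.AtomisticToContinuum.Crystallization.Theorems.ExcessDecayLiouvilleCoarseGrains (hcpEnergySeries_of_eq)

/-- Euclidean `3`-space. [folklore] -/
local notation "E3" => EuclideanSpace ℝ (Fin 3)

/-! ## Registered stubs (the only sorries of the file) — VERBATIM the three stubs of 13603's `Lines/exact_star_shortcut.lean` -/

/-- **X1 `stub_funnelDefectFloor` — THE LOAD-BEARING STUB (XL; = lead c8's registered CORE of crux 13603, line `palm-good-law`,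
VERBATIM name and signature: one proof closes it on both cruxes).**  ROBUST FUNNEL FLOOR: for the relaxed reference `(a₀, h₀)` (window +
global `hcpE`-minimality as inputs; exists, unique, landed p113318/p116871) and every hard core `δ > 0` there is `κ > 0` such that for every
measurable `Dm` agreeing on rooted `δ`-hard-core configurations with
`D(μ) = min (starDefect a₀ h₀ μ) (⨅_A Σ_{p ∈ fccKissingPattern} infDist(A(a₀ p), rootStar μ)²) + #{atoms y : 11/10 < ‖y‖ ≤ 5/4}`, and every
point-stationary rooted `δ`-hard-core probability law `P` a.s. carried by everywhere-`SetGood` Barlow-charted (window `6/5`) configurations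
in FORCE BALANCE at every point and with ZERO MEAN VIRIAL STRESS: `hcpE a₀ h₀ + κ · E_P[Dm] ≤ E_P[h]`.
Why plausibly true (13603 leads c6–c8, this crux's leads c1–c3): relaxed hcp is the strict, linearly coercive minimiser among funnel laws —
excess/defect ratios from the numerics: affine modes `≥ 0.7`, point-defect modes `≈ 0.4`, hcp phonons `λ_D = 0.263` (Bloch truth, c2/c3),
fcc-type laws `≈ 1e-4 / 1e-8 ≫ 1`, non-laminar equilibria `≥ 4e-3`; every period-`≤ 8` polytype `≥ +9.7e-6` and fcc `+7.185e-5` above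
`e_hcp,min` on the whole tube (Disproof §23, interval-certified).  Architecture (c8 NOTES E0–E6): reduction to extreme laws (Bauer, landed
`BauerMinimum` p149734), expansion of every bond at the law's mean squared length (affine first order vanishes identically), laminar-affine
floor with modulus (finite-dimensional, kit-certifiable), word-uniform fluctuation positivity (the hcp LMI of this crux's lead is its main
cell), cable/third-order taxes.  Why it might fail: an in-funnel stationary modulation or a faulted-and-relaxed law with excess/defect below
every κ (none known); real risk SIZE (word-uniform certified positivity on the 1/20 funnel, wider than the 1 % tube).  Disprover target: a
force-balanced zero-stress funnel law with `E_P[h] − hcpE < 1e-3 · E_P[D]`. [folklore] -/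
theorem stub_funnelDefectFloor :
    ∀ a₀ h₀ : ℝ, 189 / 200 ≤ a₀ → a₀ ≤ 199 / 200 → 77 / 100 ≤ h₀ → h₀ ≤ 163 / 200 →
      (∀ a h : ℝ, 0 < a → 0 < h →
        Summit.AtomisticToContinuum.Crystallization.Theorems.PalmUnimodularRigidity.LayeredLawsSelectHcp.hcpE a₀ h₀ ≤
          Summit.AtomisticToContinuum.Crystallization.Theorems.PalmUnimodularRigidity.LayeredLawsSelectHcp.hcpE a h) →
      ∀ δ : ℝ, 0 < δ → ∃ κ : ℝ, 0 < κ ∧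
        ∀ Dm : Measure (EuclideanSpace ℝ (Fin 3)) → ℝ≥0∞, Measurable Dm →
          (∀ μ : Measure (EuclideanSpace ℝ (Fin 3)), IsRootedHardCore δ μ →
            Dm μ = ENNReal.ofReal
              (min (Summit.AtomisticToContinuum.Crystallization.Theorems.PalmUnimodularRigidity.LayeredLawsSelectHcp.starDefect a₀ h₀ μ)
                  (⨅ A : EuclideanSpace ℝ (Fin 3) ≃ₗᵢ[ℝ] EuclideanSpace ℝ (Fin 3),
                    ∑ p ∈ fccKissingPattern, Metric.infDist (A (a₀ • p)) (Summit.AtomisticToContinuum.Crystallization.Theorems.PalmUnimodularRigidity.LayeredLawsSelectHcp.rootStar μ) ^ 2) +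
                (μ {y : EuclideanSpace ℝ (Fin 3) | 11 / 10 < ‖y‖ ∧ ‖y‖ ≤ 5 / 4}).toReal)) →
          ∀ P : Measure (Measure (EuclideanSpace ℝ (Fin 3))), IsProbabilityMeasure P →
            (∀ᵐ μ ∂P, IsRootedHardCore δ μ) → IsPointStationaryLaw P →
            (∀ᵐ μ ∂P, ∃ S : Set (EuclideanSpace ℝ (Fin 3)),
              μ = (Measure.count : Measure (EuclideanSpace ℝ (Fin 3))).restrict S ∧
              (∀ y ∈ S, SetGood S y) ∧
              ∃ s : ℤ → ℤ, IsHaggSeq s ∧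
                ∃ Φ : EuclideanSpace ℝ (Fin 3) → EuclideanSpace ℝ (Fin 3),
                  Set.BijOn Φ (barlowStacking 1 (Real.sqrt (2 / 3)) s) S ∧
                  ∀ p ∈ barlowStacking 1 (Real.sqrt (2 / 3)) s, ∀ q ∈ barlowStacking 1 (Real.sqrt (2 / 3)) s,
                    (dist p q = 1 ↔ (0 < dist (Φ p) (Φ q) ∧ dist (Φ p) (Φ q) < 6 / 5))) →
            (∀ᵐ μ ∂P, ∃ S : Set (EuclideanSpace ℝ (Fin 3)),
              μ = (Measure.count : Measure (EuclideanSpace ℝ (Fin 3))).restrict S ∧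
              ∀ p ∈ S, HasSum (fun q : {q : EuclideanSpace ℝ (Fin 3) // q ∈ S ∧ q ≠ p} =>
                (deriv lennardJones (dist p q.1) / dist p q.1) • (p - q.1)) 0) →
            (∀ M : EuclideanSpace ℝ (Fin 3) →L[ℝ] EuclideanSpace ℝ (Fin 3),
              ∫ μ, (∫ y, deriv lennardJones ‖y‖ / ‖y‖ * inner ℝ y (M y) ∂μ) ∂P = 0) →
            Summit.AtomisticToContinuum.Crystallization.Theorems.PalmUnimodularRigidity.LayeredLawsSelectHcp.hcpE a₀ h₀ +
                κ * (∫⁻ μ, Dm μ ∂P).toReal ≤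
              ∫ μ, (∫ y, lennardJones ‖y‖ ∂μ) / 2 ∂P := by
  sorry


/-- **X2 `stub_exactStarRigidity` (M/L; tolerance-ZERO geometry, no potential, no measure; VERBATIM 13603's X2, `stub-add`ed there).**
EXACT STARS EVERYWHERE ⇒ AN EXACT STACKING: `(a₀,h₀)` in the reference box, `0 ∈ S`, all points `SetGood`, a funnel chart
(`Φ : barlowStacking 1 √(2/3) s → S` bijective, ideal contacts `↔` pairs at distance in `(0, 6/5)`), and at EVERY `x ∈ S` the re-rooted star
has congruence defect `0` against `refStar a₀ h₀` OR against `a₀ • fccKissingPattern`, with no atom at distance in `(11/10, 5/4]` — then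
`S = A '' barlowStacking a₀ h s'` for one linear isometry `A`, a Hägg word `s'` and `h ∈ {h₀, a₀√(2/3)}`.  Proof sketch (13603 strategist
gen 2, numerically checked rigidity facts): the star has exactly twelve points (`TwelveNeighbours.stub_twelveNeighbours` p139871, radii
`≤ 0.9971 < 11/10`), so `star(x) = A_x(Ref_{t(x)})`; propagate LAYER BY LAYER (hexagon + one polar triangle determine the opposite triangle
uniquely for the relaxed/ideal anticuboctahedron and the cuboctahedron — bond-wise propagation is ambiguous at ideal-ratio polar vertices);
the spacing read from an h-site is `h₀`, from a c-site `a₀√(2/3)`, and both letters coexist only if `√(a₀²/3 + h₀²) = a₀`; rebase at the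
root's label (`BarlowStackingWindowRebase`).  The hcp-word special case is LANDED on THIS crux: `stub_localCongruence` (p102411).  Why it
might fail: Lean bookkeeping only (second distances `≥ 1.3355 > 6/5`, star radii `< 11/10` on the box). [folklore] -/
theorem stub_exactStarRigidity :
    ∀ a₀ h₀ : ℝ, 189 / 200 ≤ a₀ → a₀ ≤ 199 / 200 → 77 / 100 ≤ h₀ → h₀ ≤ 163 / 200 →
      ∀ S : Set (EuclideanSpace ℝ (Fin 3)), (0 : EuclideanSpace ℝ (Fin 3)) ∈ S →
        (∀ y ∈ S, SetGood S y) →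
        (∃ s : ℤ → ℤ, IsHaggSeq s ∧
          ∃ Φ : EuclideanSpace ℝ (Fin 3) → EuclideanSpace ℝ (Fin 3),
            Set.BijOn Φ (barlowStacking 1 (Real.sqrt (2 / 3)) s) S ∧
            ∀ p ∈ barlowStacking 1 (Real.sqrt (2 / 3)) s, ∀ q ∈ barlowStacking 1 (Real.sqrt (2 / 3)) s,
              (dist p q = 1 ↔ (0 < dist (Φ p) (Φ q) ∧ dist (Φ p) (Φ q) < 6 / 5))) →
        (∀ x ∈ S,
          (Summit.AtomisticToContinuum.Crystallization.Theorems.PalmUnimodularRigidity.LayeredLawsSelectHcp.starDefect a₀ h₀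
              ((Measure.count : Measure (EuclideanSpace ℝ (Fin 3))).restrict ((fun z : EuclideanSpace ℝ (Fin 3) => z - x) '' S)) = 0 ∨
            (⨅ A : EuclideanSpace ℝ (Fin 3) ≃ₗᵢ[ℝ] EuclideanSpace ℝ (Fin 3),
              ∑ p ∈ fccKissingPattern, Metric.infDist (A (a₀ • p))
                (Summit.AtomisticToContinuum.Crystallization.Theorems.PalmUnimodularRigidity.LayeredLawsSelectHcp.rootStar
                  ((Measure.count : Measure (EuclideanSpace ℝ (Fin 3))).restrict ((fun z : EuclideanSpace ℝ (Fin 3) => z - x) '' S))) ^ 2) = 0) ∧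
          (Measure.count : Measure (EuclideanSpace ℝ (Fin 3))).restrict ((fun z : EuclideanSpace ℝ (Fin 3) => z - x) '' S)
            {y : EuclideanSpace ℝ (Fin 3) | 11 / 10 < ‖y‖ ∧ ‖y‖ ≤ 5 / 4} = 0) →
        ∃ A : EuclideanSpace ℝ (Fin 3) ≃ₗᵢ[ℝ] EuclideanSpace ℝ (Fin 3), ∃ h : ℝ, (h = h₀ ∨ h = a₀ * Real.sqrt (2 / 3)) ∧
          ∃ s' : ℤ → ℤ, IsHaggSeq s' ∧ S = A '' barlowStacking a₀ h s' := by
  sorry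


/-- **X3 `stub_exactSelectionLaw` (M; law-level bookkeeping over LANDED energetics; VERBATIM 13603's X3, `stub-add`ed there).**
SELECTION AT EXACT GEOMETRY: for the relaxed reference `(a₀,h₀)` (box + global `hcpE`-minimality), a point-stationary probability law on
rooted `δ`-hard-core configurations which is a.s. `count|A(barlowStacking a₀ h s)` with `h ∈ {h₀, a₀√(2/3)}` and has `E_P[h] ≤ hcpE a₀ h₀`
is a.s. `count|A(hcpStacking a₀ h₀)`.  Intended proof: root energy of `count|A(barlowStacking a₀ h s)` = `barlowSiteEnergy lennardJones a₀ h s 0`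
(regrouping by layers: `tsum_points_eq_two_mul_barlowSiteEnergy`, `summable_lennardJones_barlowPos`, `barlowPos_injective`, landed in
`Theorems/MinMeanCycleStackingLockBarlowEnergyIdentification.lean`; hcp instance = the live line's `rootEnergy_isometric_hcp`); both spacings in
the column box by the enclosure `tube_minimiserEnclosure` (p143804); the LANDED column `SiteColumnLJ.stub_siteColumnLJ` (p141765):
`root energy ≥ hcpE a₀ h + ½(J₃ − J₂)(c(1) + c(−1))`, `J₃ − J₂ > 0`; `E_P[h] ≤ hcpE a₀ h₀ ≤ hcpE a₀ h` forces a.s. equality, so `h = h₀`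
(`tube_hcpE_unique_minimiser` p116871) and no cubic layer next to the root; by `ae_forall_map_sub_of_ae` no layer is cubic, the word is
`± alternatingHagg` up to shift, and `A '' barlowStacking a₀ h₀ s = A' '' hcpStacking a₀ h₀` (`hcpStacking_homogeneous`).  This is the EXACT
(tolerance-0) shadow of the live line's `stub_selectionFloor`: the same letter price, with NO relaxation to fight.  Why it might fail: not on
the energetics (landed); `tsum` regrouping and measurability plumbing. [folklore] -/
theorem stub_exactSelectionLaw :
    ∀ a₀ h₀ : ℝ, 189 / 200 ≤ a₀ → a₀ ≤ 199 / 200 → 77 / 100 ≤ h₀ → h₀ ≤ 163 / 200 →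
      (∀ a h : ℝ, 0 < a → 0 < h →
        Summit.AtomisticToContinuum.Crystallization.Theorems.PalmUnimodularRigidity.LayeredLawsSelectHcp.hcpE a₀ h₀ ≤
          Summit.AtomisticToContinuum.Crystallization.Theorems.PalmUnimodularRigidity.LayeredLawsSelectHcp.hcpE a h) →
      ∀ δ : ℝ, 0 < δ → ∀ P : Measure (Measure (EuclideanSpace ℝ (Fin 3))), IsProbabilityMeasure P →
        (∀ᵐ μ ∂P, IsRootedHardCore δ μ) → IsPointStationaryLaw P →
        (∫ μ, (∫ y, lennardJones ‖y‖ ∂μ) / 2 ∂P) ≤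
          Summit.AtomisticToContinuum.Crystallization.Theorems.PalmUnimodularRigidity.LayeredLawsSelectHcp.hcpE a₀ h₀ →
        (∀ᵐ μ ∂P, ∃ A : EuclideanSpace ℝ (Fin 3) ≃ₗᵢ[ℝ] EuclideanSpace ℝ (Fin 3), ∃ h : ℝ,
          (h = h₀ ∨ h = a₀ * Real.sqrt (2 / 3)) ∧ ∃ s : ℤ → ℤ, IsHaggSeq s ∧
            μ = (Measure.count : Measure (EuclideanSpace ℝ (Fin 3))).restrict (A '' barlowStacking a₀ h s)) →
        ∀ᵐ μ ∂P, ∃ A : EuclideanSpace ℝ (Fin 3) ≃ₗᵢ[ℝ] EuclideanSpace ℝ (Fin 3),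
          μ = (Measure.count : Measure (EuclideanSpace ℝ (Fin 3))).restrict (A '' hcpStacking a₀ h₀) := by
  sorry


/-! ## Glue 1 (no sorry): X1 forces a.s. EXACT root stars on a law at the level `hcpE a₀ h₀` (verbatim 13603's glue)

The measurable version `Dm` is assembled from the LANDED V `DefectVersion.stub_defectVersion` (p146247, twice) and A
`AnnulusCount.stub_annulusCount` (p146063); `hcpE + κ·E_P[Dm] ≤ E_P[h] ≤ hcpE` gives `E_P[Dm] = 0`, `Dm = 0` a.e. -/

/-- **CORE ⇒ a.s. exact root star** (and the level is attained: `hcpE a₀ h₀ ≤ E_P[h]`). [folklore] -/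
theorem ae_exactRoot_of_core
    (hCORE : ∀ a₀ h₀ : ℝ, 189 / 200 ≤ a₀ → a₀ ≤ 199 / 200 → 77 / 100 ≤ h₀ → h₀ ≤ 163 / 200 →
      (∀ a h : ℝ, 0 < a → 0 < h → hcpE a₀ h₀ ≤ hcpE a h) →
      ∀ δ : ℝ, 0 < δ → ∃ κ : ℝ, 0 < κ ∧
        ∀ Dm : Measure (EuclideanSpace ℝ (Fin 3)) → ℝ≥0∞, Measurable Dm →
          (∀ μ : Measure (EuclideanSpace ℝ (Fin 3)), IsRootedHardCore δ μ →
            Dm μ = ENNReal.ofReal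
              (min (starDefect a₀ h₀ μ)
                  (⨅ A : EuclideanSpace ℝ (Fin 3) ≃ₗᵢ[ℝ] EuclideanSpace ℝ (Fin 3),
                    ∑ p ∈ fccKissingPattern, Metric.infDist (A (a₀ • p)) (rootStar μ) ^ 2) +
                (μ {y : EuclideanSpace ℝ (Fin 3) | 11 / 10 < ‖y‖ ∧ ‖y‖ ≤ 5 / 4}).toReal)) →
          ∀ P : Measure (Measure (EuclideanSpace ℝ (Fin 3))), IsProbabilityMeasure P →
            (∀ᵐ μ ∂P, IsRootedHardCore δ μ) → IsPointStationaryLaw P →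
            (∀ᵐ μ ∂P, ∃ S : Set (EuclideanSpace ℝ (Fin 3)),
              μ = (Measure.count : Measure (EuclideanSpace ℝ (Fin 3))).restrict S ∧
              (∀ y ∈ S, SetGood S y) ∧
              ∃ s : ℤ → ℤ, IsHaggSeq s ∧
                ∃ Φ : EuclideanSpace ℝ (Fin 3) → EuclideanSpace ℝ (Fin 3),
                  Set.BijOn Φ (barlowStacking 1 (Real.sqrt (2 / 3)) s) S ∧
                  ∀ p ∈ barlowStacking 1 (Real.sqrt (2 / 3)) s, ∀ q ∈ barlowStacking 1 (Real.sqrt (2 / 3)) s,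
                    (dist p q = 1 ↔ (0 < dist (Φ p) (Φ q) ∧ dist (Φ p) (Φ q) < 6 / 5))) →
            (∀ᵐ μ ∂P, ∃ S : Set (EuclideanSpace ℝ (Fin 3)),
              μ = (Measure.count : Measure (EuclideanSpace ℝ (Fin 3))).restrict S ∧
              ∀ p ∈ S, HasSum (fun q : {q : EuclideanSpace ℝ (Fin 3) // q ∈ S ∧ q ≠ p} =>
                (deriv lennardJones (dist p q.1) / dist p q.1) • (p - q.1)) 0) →
            (∀ M : EuclideanSpace ℝ (Fin 3) →L[ℝ] EuclideanSpace ℝ (Fin 3),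
              ∫ μ, (∫ y, deriv lennardJones ‖y‖ / ‖y‖ * inner ℝ y (M y) ∂μ) ∂P = 0) →
            hcpE a₀ h₀ + κ * (∫⁻ μ, Dm μ ∂P).toReal ≤ ∫ μ, (∫ y, lennardJones ‖y‖ ∂μ) / 2 ∂P)
    {a₀ h₀ : ℝ} (ha₁ : 189 / 200 ≤ a₀) (ha₂ : a₀ ≤ 199 / 200) (hh₁ : 77 / 100 ≤ h₀) (hh₂ : h₀ ≤ 163 / 200)
    (hmin : ∀ a h : ℝ, 0 < a → 0 < h → hcpE a₀ h₀ ≤ hcpE a h)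
    {δ : ℝ} (hδ : 0 < δ) {P : Measure (Measure (EuclideanSpace ℝ (Fin 3)))} [hP : IsProbabilityMeasure P]
    (hhc : ∀ᵐ μ ∂P, IsRootedHardCore δ μ) (hstat : IsPointStationaryLaw P)
    (hchart : ∀ᵐ μ ∂P, ∃ S : Set (EuclideanSpace ℝ (Fin 3)),
      μ = (Measure.count : Measure (EuclideanSpace ℝ (Fin 3))).restrict S ∧
      (∀ y ∈ S, SetGood S y) ∧
      ∃ s : ℤ → ℤ, IsHaggSeq s ∧
        ∃ Φ : EuclideanSpace ℝ (Fin 3) → EuclideanSpace ℝ (Fin 3),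
          Set.BijOn Φ (barlowStacking 1 (Real.sqrt (2 / 3)) s) S ∧
          ∀ p ∈ barlowStacking 1 (Real.sqrt (2 / 3)) s, ∀ q ∈ barlowStacking 1 (Real.sqrt (2 / 3)) s,
            (dist p q = 1 ↔ (0 < dist (Φ p) (Φ q) ∧ dist (Φ p) (Φ q) < 6 / 5)))
    (hFB : ∀ᵐ μ ∂P, ∃ S : Set (EuclideanSpace ℝ (Fin 3)),
      μ = (Measure.count : Measure (EuclideanSpace ℝ (Fin 3))).restrict S ∧
      ∀ p ∈ S, HasSum (fun q : {q : EuclideanSpace ℝ (Fin 3) // q ∈ S ∧ q ≠ p} =>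
        (deriv lennardJones (dist p q.1) / dist p q.1) • (p - q.1)) 0)
    (hZS : ∀ M : EuclideanSpace ℝ (Fin 3) →L[ℝ] EuclideanSpace ℝ (Fin 3),
      ∫ μ, (∫ y, deriv lennardJones ‖y‖ / ‖y‖ * inner ℝ y (M y) ∂μ) ∂P = 0)
    (hlevel : (∫ μ, (∫ y, lennardJones ‖y‖ ∂μ) / 2 ∂P) ≤ hcpE a₀ h₀) :
    hcpE a₀ h₀ ≤ (∫ μ, (∫ y, lennardJones ‖y‖ ∂μ) / 2 ∂P) ∧
    ∀ᵐ μ ∂P,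
      (starDefect a₀ h₀ μ = 0 ∨
        (⨅ A : EuclideanSpace ℝ (Fin 3) ≃ₗᵢ[ℝ] EuclideanSpace ℝ (Fin 3),
          ∑ p ∈ fccKissingPattern, Metric.infDist (A (a₀ • p)) (rootStar μ) ^ 2) = 0) ∧
      μ {y : EuclideanSpace ℝ (Fin 3) | 11 / 10 < ‖y‖ ∧ ‖y‖ ≤ 5 / 4} = 0 := by
  classical
  obtain ⟨κ, hκ, hcore⟩ := hCORE a₀ h₀ ha₁ ha₂ hh₁ hh₂ hmin δ hδ
  -- measurable versions of the two star defects (V, instantiated twice) and the annulus packing bound (A)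
  set eH := (hcpStarIdx).equivFin with heH
  obtain ⟨Dh, hDh_m, hDh_le, hDh_eq⟩ :=
    Summit.AtomisticToContinuum.Crystallization.Theorems.PalmGoodLaw.DefectVersion.stub_defectVersion _
      (fun i => hcpSite a₀ h₀ ((eH.symm i : hcpStarIdx) : ℤ × ℤ × ℤ)) δ hδ
  set eF := (fccKissingPattern).equivFin with heF
  obtain ⟨Df, hDf_m, hDf_le, hDf_eq⟩ :=
    Summit.AtomisticToContinuum.Crystallization.Theorems.PalmGoodLaw.DefectVersion.stub_defectVersion _
      (fun i => a₀ • ((eF.symm i : fccKissingPattern) : E3)) δ hδ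
  obtain ⟨N, hN⟩ :=
    Summit.AtomisticToContinuum.Crystallization.Theorems.PalmGoodLaw.AnnulusCount.stub_annulusCount δ hδ
  -- the annulus event and the measurable version `Dm` of the defect functional
  set ann : Set E3 := {y : E3 | 11 / 10 < ‖y‖ ∧ ‖y‖ ≤ 5 / 4} with hann
  have hann_m : MeasurableSet ann :=
    (measurableSet_lt measurable_const measurable_norm).inter (measurableSet_le measurable_norm measurable_const)
  set Dm : Measure E3 → ℝ≥0∞ := fun μ => min (Dh μ) (Df μ) + μ ann with hDm
  have hDm_m : Measurable Dm := (hDh_m.min hDf_m).add (Measure.measurable_coe hann_m)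
  -- read-backs of the two instantiated sums
  have hsumH : ∀ (A : E3 ≃ₗᵢ[ℝ] E3) (μ : Measure E3),
      (∑ i, Metric.infDist (A (hcpSite a₀ h₀ ((eH.symm i : hcpStarIdx) : ℤ × ℤ × ℤ))) (rootStar μ) ^ 2) =
        ∑ v ∈ hcpStarIdx, Metric.infDist (A (hcpSite a₀ h₀ v)) (rootStar μ) ^ 2 := by
    intro A μ
    rw [← Finset.sum_coe_sort hcpStarIdx
      (fun v : ℤ × ℤ × ℤ => Metric.infDist (A (hcpSite a₀ h₀ v)) (rootStar μ) ^ 2)]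
    exact Fintype.sum_equiv eH.symm _ _ (fun i => rfl)
  have hsumF : ∀ (A : E3 ≃ₗᵢ[ℝ] E3) (μ : Measure E3),
      (∑ i, Metric.infDist (A (a₀ • ((eF.symm i : fccKissingPattern) : E3))) (rootStar μ) ^ 2) =
        ∑ p ∈ fccKissingPattern, Metric.infDist (A (a₀ • p)) (rootStar μ) ^ 2 := by
    intro A μ
    rw [← Finset.sum_coe_sort fccKissingPattern
      (fun p : E3 => Metric.infDist (A (a₀ • p)) (rootStar μ) ^ 2)]
    exact Fintype.sum_equiv eF.symm _ _ (fun i => rfl)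
  have hstar : ∀ μ : Measure E3, IsRootedHardCore δ μ →
      Dh μ = ENNReal.ofReal (starDefect a₀ h₀ μ) := by
    intro μ hμ
    rw [hDh_eq μ hμ]
    simp_rw [hsumH]
    rfl
  have hfcc : ∀ μ : Measure E3, IsRootedHardCore δ μ →
      Df μ = ENNReal.ofReal (⨅ A : E3 ≃ₗᵢ[ℝ] E3,
        ∑ p ∈ fccKissingPattern, Metric.infDist (A (a₀ • p)) (rootStar μ) ^ 2) := by
    intro μ hμ
    rw [hDf_eq μ hμ]
    simp_rw [hsumF]
  have hann_fin : ∀ μ : Measure E3, IsRootedHardCore δ μ → μ ann ≠ ⊤ := fun μ hμ =>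
    ne_top_of_le_ne_top (ENNReal.natCast_ne_top N) (hN μ hμ)
  have hfcc_nonneg : ∀ μ : Measure E3, 0 ≤ ⨅ A : E3 ≃ₗᵢ[ℝ] E3,
      ∑ p ∈ fccKissingPattern, Metric.infDist (A (a₀ • p)) (rootStar μ) ^ 2 :=
    fun μ => Real.iInf_nonneg fun _ => Finset.sum_nonneg fun _ _ => sq_nonneg _
  have hagree : ∀ μ : Measure E3, IsRootedHardCore δ μ →
      Dm μ = ENNReal.ofReal
        (min (starDefect a₀ h₀ μ)
            (⨅ A : E3 ≃ₗᵢ[ℝ] E3,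
              ∑ p ∈ fccKissingPattern, Metric.infDist (A (a₀ • p)) (rootStar μ) ^ 2) +
          (μ {y : E3 | 11 / 10 < ‖y‖ ∧ ‖y‖ ≤ 5 / 4}).toReal) := by
    intro μ hμ
    have hmono : Monotone ENNReal.ofReal := fun _ _ h => ENNReal.ofReal_le_ofReal h
    rw [ENNReal.ofReal_add (le_min (starDefect_nonneg a₀ h₀ μ) (hfcc_nonneg μ)) ENNReal.toReal_nonneg,
      hmono.map_min, ENNReal.ofReal_toReal (hann_fin μ hμ), hDm]
    simp only
    rw [hstar μ hμ, hfcc μ hμ]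
  -- the floor on `P`
  have hfloor := hcore Dm hDm_m hagree P hP hhc hstat hchart hFB hZS
  -- finiteness of `E_P[Dm]`
  have hbound : ∀ᵐ μ ∂P, Dm μ ≤
      ENNReal.ofReal (∑ i, (‖hcpSite a₀ h₀ ((eH.symm i : hcpStarIdx) : ℤ × ℤ × ℤ)‖ + 11 / 10) ^ 2) + N := by
    filter_upwards [hhc] with μ hμ
    exact add_le_add ((min_le_left _ _).trans (hDh_le μ)) (hN μ hμ)
  have hfin : ∫⁻ μ, Dm μ ∂P ≠ ⊤ := by
    refine ne_top_of_le_ne_top ?_ (lintegral_mono_ae hbound)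
    rw [lintegral_const, measure_univ, mul_one]
    exact ENNReal.add_ne_top.2 ⟨ENNReal.ofReal_ne_top, ENNReal.natCast_ne_top N⟩
  -- the level is attained and `E_P[Dm] = 0`
  have hnonneg : 0 ≤ κ * (∫⁻ μ, Dm μ ∂P).toReal := mul_nonneg hκ.le ENNReal.toReal_nonneg
  refine ⟨by linarith, ?_⟩
  have htr0 : (∫⁻ μ, Dm μ ∂P).toReal = 0 := by
    have h1 : κ * (∫⁻ μ, Dm μ ∂P).toReal ≤ κ * 0 := by rw [mul_zero]; linarith
    exact le_antisymm (le_of_mul_le_mul_left h1 hκ) ENNReal.toReal_nonneg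
  have hl0 : ∫⁻ μ, Dm μ ∂P = 0 := by
    rcases (ENNReal.toReal_eq_zero_iff _).1 htr0 with h | h
    · exact h
    · exact absurd h hfin
  have hae0 : ∀ᵐ μ ∂P, Dm μ = 0 := (lintegral_eq_zero_iff' hDm_m.aemeasurable).1 hl0
  filter_upwards [hae0, hhc] with μ h0 hμ
  have hD := hagree μ hμ
  rw [h0] at hD
  have hle := ENNReal.ofReal_eq_zero.1 hD.symm
  have hmin0 : 0 ≤ min (starDefect a₀ h₀ μ)
      (⨅ A : E3 ≃ₗᵢ[ℝ] E3, ∑ p ∈ fccKissingPattern, Metric.infDist (A (a₀ • p)) (rootStar μ) ^ 2) :=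
    le_min (starDefect_nonneg a₀ h₀ μ) (hfcc_nonneg μ)
  have htR : 0 ≤ (μ {y : E3 | 11 / 10 < ‖y‖ ∧ ‖y‖ ≤ 5 / 4}).toReal := ENNReal.toReal_nonneg
  have hm : min (starDefect a₀ h₀ μ)
      (⨅ A : E3 ≃ₗᵢ[ℝ] E3, ∑ p ∈ fccKissingPattern, Metric.infDist (A (a₀ • p)) (rootStar μ) ^ 2) = 0 := by
    linarith
  have ht : (μ {y : E3 | 11 / 10 < ‖y‖ ∧ ‖y‖ ≤ 5 / 4}).toReal = 0 := by linarith
  refine ⟨?_, ?_⟩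
  · rcases min_eq_iff.1 hm with h | h
    · exact Or.inl h.1
    · exact Or.inr h.1
  · rcases (ENNReal.toReal_eq_zero_iff _).1 ht with h | h
    · exact h
    · exact absurd h (hann_fin μ hμ)


/-! ## Glue 2 (no sorry): LAYERED LAW RIGIDITY — the crux's conclusion from X1 + X2 + X3

For a MINIMISING point-stationary LAYERED law (the crux's H2–H4; H1 is redundant): hard core, force balance, zero mean stress and the
funnel chart are landed consequences; X1 makes the root star exact a.s. and pins `hcpE a₀ h₀ = e*`; Aldous–Lyons moves exactness to
every point; X2 gives an exact stacking; X3 selects hcp. -/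

/-- **X1 → X2 → X3 → a.s. `IsRelaxedHcp`** for minimising point-stationary layered laws (sorry-free glue; the three stub statements are
hypotheses, so the axiom closure is clean). [folklore] -/
theorem layeredRigidity_of_stubs
    (hCORE : ∀ a₀ h₀ : ℝ, 189 / 200 ≤ a₀ → a₀ ≤ 199 / 200 → 77 / 100 ≤ h₀ → h₀ ≤ 163 / 200 →
      (∀ a h : ℝ, 0 < a → 0 < h → hcpE a₀ h₀ ≤ hcpE a h) →
      ∀ δ : ℝ, 0 < δ → ∃ κ : ℝ, 0 < κ ∧
        ∀ Dm : Measure (EuclideanSpace ℝ (Fin 3)) → ℝ≥0∞, Measurable Dm →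
          (∀ μ : Measure (EuclideanSpace ℝ (Fin 3)), IsRootedHardCore δ μ →
            Dm μ = ENNReal.ofReal
              (min (starDefect a₀ h₀ μ)
                  (⨅ A : EuclideanSpace ℝ (Fin 3) ≃ₗᵢ[ℝ] EuclideanSpace ℝ (Fin 3),
                    ∑ p ∈ fccKissingPattern, Metric.infDist (A (a₀ • p)) (rootStar μ) ^ 2) +
                (μ {y : EuclideanSpace ℝ (Fin 3) | 11 / 10 < ‖y‖ ∧ ‖y‖ ≤ 5 / 4}).toReal)) →
          ∀ P : Measure (Measure (EuclideanSpace ℝ (Fin 3))), IsProbabilityMeasure P →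
            (∀ᵐ μ ∂P, IsRootedHardCore δ μ) → IsPointStationaryLaw P →
            (∀ᵐ μ ∂P, ∃ S : Set (EuclideanSpace ℝ (Fin 3)),
              μ = (Measure.count : Measure (EuclideanSpace ℝ (Fin 3))).restrict S ∧
              (∀ y ∈ S, SetGood S y) ∧
              ∃ s : ℤ → ℤ, IsHaggSeq s ∧
                ∃ Φ : EuclideanSpace ℝ (Fin 3) → EuclideanSpace ℝ (Fin 3),
                  Set.BijOn Φ (barlowStacking 1 (Real.sqrt (2 / 3)) s) S ∧
                  ∀ p ∈ barlowStacking 1 (Real.sqrt (2 / 3)) s, ∀ q ∈ barlowStacking 1 (Real.sqrt (2 / 3)) s,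
                    (dist p q = 1 ↔ (0 < dist (Φ p) (Φ q) ∧ dist (Φ p) (Φ q) < 6 / 5))) →
            (∀ᵐ μ ∂P, ∃ S : Set (EuclideanSpace ℝ (Fin 3)),
              μ = (Measure.count : Measure (EuclideanSpace ℝ (Fin 3))).restrict S ∧
              ∀ p ∈ S, HasSum (fun q : {q : EuclideanSpace ℝ (Fin 3) // q ∈ S ∧ q ≠ p} =>
                (deriv lennardJones (dist p q.1) / dist p q.1) • (p - q.1)) 0) →
            (∀ M : EuclideanSpace ℝ (Fin 3) →L[ℝ] EuclideanSpace ℝ (Fin 3),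
              ∫ μ, (∫ y, deriv lennardJones ‖y‖ / ‖y‖ * inner ℝ y (M y) ∂μ) ∂P = 0) →
            hcpE a₀ h₀ + κ * (∫⁻ μ, Dm μ ∂P).toReal ≤ ∫ μ, (∫ y, lennardJones ‖y‖ ∂μ) / 2 ∂P)
    (hE1 : ∀ a₀ h₀ : ℝ, 189 / 200 ≤ a₀ → a₀ ≤ 199 / 200 → 77 / 100 ≤ h₀ → h₀ ≤ 163 / 200 →
      ∀ S : Set (EuclideanSpace ℝ (Fin 3)), (0 : EuclideanSpace ℝ (Fin 3)) ∈ S →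
        (∀ y ∈ S, SetGood S y) →
        (∃ s : ℤ → ℤ, IsHaggSeq s ∧
          ∃ Φ : EuclideanSpace ℝ (Fin 3) → EuclideanSpace ℝ (Fin 3),
            Set.BijOn Φ (barlowStacking 1 (Real.sqrt (2 / 3)) s) S ∧
            ∀ p ∈ barlowStacking 1 (Real.sqrt (2 / 3)) s, ∀ q ∈ barlowStacking 1 (Real.sqrt (2 / 3)) s,
              (dist p q = 1 ↔ (0 < dist (Φ p) (Φ q) ∧ dist (Φ p) (Φ q) < 6 / 5))) →
        (∀ x ∈ S,
          (starDefect a₀ h₀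
              ((Measure.count : Measure (EuclideanSpace ℝ (Fin 3))).restrict ((fun z : EuclideanSpace ℝ (Fin 3) => z - x) '' S)) = 0 ∨
            (⨅ A : EuclideanSpace ℝ (Fin 3) ≃ₗᵢ[ℝ] EuclideanSpace ℝ (Fin 3),
              ∑ p ∈ fccKissingPattern, Metric.infDist (A (a₀ • p))
                (rootStar ((Measure.count : Measure (EuclideanSpace ℝ (Fin 3))).restrict
                  ((fun z : EuclideanSpace ℝ (Fin 3) => z - x) '' S))) ^ 2) = 0) ∧
          (Measure.count : Measure (EuclideanSpace ℝ (Fin 3))).restrict ((fun z : EuclideanSpace ℝ (Fin 3) => z - x) '' S)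
            {y : EuclideanSpace ℝ (Fin 3) | 11 / 10 < ‖y‖ ∧ ‖y‖ ≤ 5 / 4} = 0) →
        ∃ A : EuclideanSpace ℝ (Fin 3) ≃ₗᵢ[ℝ] EuclideanSpace ℝ (Fin 3), ∃ h : ℝ, (h = h₀ ∨ h = a₀ * Real.sqrt (2 / 3)) ∧
          ∃ s' : ℤ → ℤ, IsHaggSeq s' ∧ S = A '' barlowStacking a₀ h s')
    (hE2 : ∀ a₀ h₀ : ℝ, 189 / 200 ≤ a₀ → a₀ ≤ 199 / 200 → 77 / 100 ≤ h₀ → h₀ ≤ 163 / 200 →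
      (∀ a h : ℝ, 0 < a → 0 < h → hcpE a₀ h₀ ≤ hcpE a h) →
      ∀ δ : ℝ, 0 < δ → ∀ P : Measure (Measure (EuclideanSpace ℝ (Fin 3))), IsProbabilityMeasure P →
        (∀ᵐ μ ∂P, IsRootedHardCore δ μ) → IsPointStationaryLaw P →
        (∫ μ, (∫ y, lennardJones ‖y‖ ∂μ) / 2 ∂P) ≤ hcpE a₀ h₀ →
        (∀ᵐ μ ∂P, ∃ A : EuclideanSpace ℝ (Fin 3) ≃ₗᵢ[ℝ] EuclideanSpace ℝ (Fin 3), ∃ h : ℝ,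
          (h = h₀ ∨ h = a₀ * Real.sqrt (2 / 3)) ∧ ∃ s : ℤ → ℤ, IsHaggSeq s ∧
            μ = (Measure.count : Measure (EuclideanSpace ℝ (Fin 3))).restrict (A '' barlowStacking a₀ h s)) →
        ∀ᵐ μ ∂P, ∃ A : EuclideanSpace ℝ (Fin 3) ≃ₗᵢ[ℝ] EuclideanSpace ℝ (Fin 3),
          μ = (Measure.count : Measure (EuclideanSpace ℝ (Fin 3))).restrict (A '' hcpStacking a₀ h₀)) :
    ∀ P : Measure (Measure E3), IsProbabilityMeasure P → PointStationary P →
      meanRootEnergy P ≤ eStar → Layered P → ∀ᵐ μ ∂P, IsRelaxedHcp μ := by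
  intro P hP hstat hE hL
  -- the `e*`-level structure of a minimising layered law: hard core, chart, force balance, zero mean stress (all LANDED)
  have hδ : (0 : ℝ) < 891 / 1000 := by norm_num
  have hcore : ∀ᵐ μ ∂P, IsRootedHardCore (891 / 1000) μ := ae_isRootedHardCore_of_layered hstat hL
  have hstat' : IsPointStationaryLaw P := hstat
  have hE' : (∫ μ, (∫ y, lennardJones ‖y‖ ∂μ) / 2 ∂P) ≤
      (⨅ Q : PeriodicConfiguration 3, Q.energyPerParticle lennardJones) := hE
  -- tube ⊂ funnel (p149307): `SetGood` everywhere and the funnel chart with window `6/5`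
  have hchart : ∀ᵐ μ ∂P, ∃ S : Set (EuclideanSpace ℝ (Fin 3)),
      μ = (Measure.count : Measure (EuclideanSpace ℝ (Fin 3))).restrict S ∧
      (∀ y ∈ S, SetGood S y) ∧
      ∃ s : ℤ → ℤ, IsHaggSeq s ∧
        ∃ Φ : EuclideanSpace ℝ (Fin 3) → EuclideanSpace ℝ (Fin 3),
          Set.BijOn Φ (barlowStacking 1 (Real.sqrt (2 / 3)) s) S ∧
          ∀ p ∈ barlowStacking 1 (Real.sqrt (2 / 3)) s, ∀ q ∈ barlowStacking 1 (Real.sqrt (2 / 3)) s,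
            (dist p q = 1 ↔ (0 < dist (Φ p) (Φ q) ∧ dist (Φ p) (Φ q) < 6 / 5)) := by
    filter_upwards [hL] with μ hμ
    obtain ⟨S, hμS, hgood, hBL⟩ := hμ
    obtain ⟨hsg, s, hs, Φ, hbij, hiso⟩ :=
      Summit.AtomisticToContinuum.Crystallization.Theorems.PalmGoodLaw.FunnelOfLayered.stub_funnelOfLayered S hgood hBL
    exact ⟨S, hμS, hsg, s, hs, Φ, hbij, hiso⟩
  -- the relaxed reference (p113318) and the level `E_P[h] ≤ e* ≤ hcpE a₀ h₀`
  obtain ⟨a₀, h₀, ha₁, ha₂, hh₁, hh₂, hmin⟩ := stub_relaxedReference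
  have ha0 : 0 < a₀ := by linarith
  have hh0 : 0 < h₀ := by linarith
  have hstar : (⨅ Q : PeriodicConfiguration 3, Q.energyPerParticle lennardJones) ≤ hcpE a₀ h₀ :=
    Summit.AtomisticToContinuum.Crystallization.Theorems.PalmGoodLaw.RouteBetaFloor.iInf_le_hcpE ha0.ne' hh0.ne'
  have hlevel : (∫ μ, (∫ y, lennardJones ‖y‖ ∂μ) / 2 ∂P) ≤ hcpE a₀ h₀ := hE'.trans hstar
  have hFB := Summit.AtomisticToContinuum.Crystallization.Theorems.PalmGoodLaw.RouteBetaFloor.ae_forceBalance_of_minimising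
    hδ hcore hstat' hE'
  have hZS := Summit.AtomisticToContinuum.Crystallization.Theorems.PalmGoodLaw.RouteBetaFloor.zeroMeanStress_of_minimising
    hδ hcore hstat' hE'
  -- X1: the level is attained and the ROOT star is a.s. exact
  obtain ⟨hlow, hexact⟩ := ae_exactRoot_of_core hCORE ha₁ ha₂ hh₁ hh₂ hmin hδ hcore hstat' hchart hFB hZS hlevel
  have heq : hcpE a₀ h₀ = ⨅ Q : PeriodicConfiguration 3, Q.energyPerParticle lennardJones :=
    le_antisymm (hlow.trans hE') hstar
  -- every point a.s. (Aldous–Lyons; hard-core configurations are locally finite)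
  have hlf : ∀ᵐ μ ∂P, ∀ n : ℕ,
      μ ((fun z : EuclideanSpace ℝ (Fin 3) => ⌊‖z‖⌋₊) ⁻¹' {n}) < ∞ := by
    filter_upwards [hcore] with μ hμ n
    obtain ⟨S, -, hsep, rfl⟩ := hμ
    exact count_restrict_floorNorm_preimage_lt_top hδ hsep n
  have hall := ae_forall_map_sub_of_ae hstat' hlf hexact
  -- X2: a.s. an exact stacking
  have hstack : ∀ᵐ μ ∂P, ∃ A : EuclideanSpace ℝ (Fin 3) ≃ₗᵢ[ℝ] EuclideanSpace ℝ (Fin 3), ∃ h : ℝ,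
      (h = h₀ ∨ h = a₀ * Real.sqrt (2 / 3)) ∧ ∃ s : ℤ → ℤ, IsHaggSeq s ∧
        μ = (Measure.count : Measure (EuclideanSpace ℝ (Fin 3))).restrict (A '' barlowStacking a₀ h s) := by
    filter_upwards [hcore, hchart, hall] with μ hc hch ha
    obtain ⟨S, hμS, hgoodS, hch'⟩ := hch
    obtain ⟨S₀, h0, -, hμ0⟩ := hc
    have h0S : (0 : EuclideanSpace ℝ (Fin 3)) ∈ S := by
      have h1 : (Measure.count : Measure (EuclideanSpace ℝ (Fin 3))).restrict S {0} ≠ 0 := by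
        rw [← hμS, hμ0]
        exact (count_restrict_singleton_ne_zero_iff S₀ 0).2 h0
      exact (count_restrict_singleton_ne_zero_iff S 0).1 h1
    have hx : ∀ x ∈ S,
        (starDefect a₀ h₀
            ((Measure.count : Measure (EuclideanSpace ℝ (Fin 3))).restrict
              ((fun z : EuclideanSpace ℝ (Fin 3) => z - x) '' S)) = 0 ∨
          (⨅ A : EuclideanSpace ℝ (Fin 3) ≃ₗᵢ[ℝ] EuclideanSpace ℝ (Fin 3),
            ∑ p ∈ fccKissingPattern, Metric.infDist (A (a₀ • p))
              (rootStar ((Measure.count : Measure (EuclideanSpace ℝ (Fin 3))).restrict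
                ((fun z : EuclideanSpace ℝ (Fin 3) => z - x) '' S))) ^ 2) = 0) ∧
        (Measure.count : Measure (EuclideanSpace ℝ (Fin 3))).restrict ((fun z : EuclideanSpace ℝ (Fin 3) => z - x) '' S)
          {y : EuclideanSpace ℝ (Fin 3) | 11 / 10 < ‖y‖ ∧ ‖y‖ ≤ 5 / 4} = 0 := by
      intro x hxS
      have h1 := ha x (by rw [hμS]; exact (count_restrict_singleton_ne_zero_iff S x).2 hxS)
      rwa [hμS, map_sub_count_restrict] at h1
    obtain ⟨A, h, hh, s', hs', hS⟩ := hE1 a₀ h₀ ha₁ ha₂ hh₁ hh₂ S h0S hgoodS hch' hx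
    exact ⟨A, h, hh, s', hs', by rw [hμS, hS]⟩
  -- X3: a.s. exact relaxed hcp
  have hhcp := hE2 a₀ h₀ ha₁ ha₂ hh₁ hh₂ hmin (891 / 1000) hδ P hP hcore hstat' hlevel hstack
  filter_upwards [hhcp] with μ hμ
  obtain ⟨A, hA⟩ := hμ
  refine ⟨a₀, h₀, ha0.ne', hh0.ne', by linarith, by linarith, by linarith, by linarith, A, ?_, hA⟩
  show (hcpPeriodicConfiguration ha0.ne' hh0.ne').energyPerParticle lennardJones =
    ⨅ Q : PeriodicConfiguration 3, Q.energyPerParticle lennardJones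
  rw [← heq]
  exact (hcpEnergySeries_of_eq a₀ h₀ ha0.ne' hh0.ne' hcpQ rfl).2.2

/-! ## The kernel-checked composition: the three stub STATEMENTS prove the crux BY NAME -/

/-- **`LayeredLawsSelectHcp_of`** — the crux `PalmUnimodularRigidity.LayeredLawsSelectHcp` BY NAME from the three registered stubs
`stub_funnelDefectFloor` (X1), `stub_exactStarRigidity` (X2), `stub_exactSelectionLaw` (X3), through the sorry-free
`layeredRigidity_of_stubs` and the definitional `Negative.DiracLaws.crux_iff`; H1 (`Rooted δ`) is not used. -/
theorem LayeredLawsSelectHcp_of : LayeredLawsSelectHcp :=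
  crux_iff.2 fun _ _ P hP _ hstat hE hL =>
    layeredRigidity_of_stubs stub_funnelDefectFloor stub_exactStarRigidity stub_exactSelectionLaw P hP hstat hE hL

/-! ## Composability with the live line (sorry-free; informational)

X1 ALONE already closes the live line's RIGIDITY core in its `e*`-form — lead c8's merge theorem
`RouteBetaTubeMerge.starDefect_ae_zero_of_funnelDefectFloor` (tree): a minimising point-stationary hcp-layered law has a.s. zero root-star
congruence defect.  So a lead holding `mtp-prestress-split-ergodic-frame` may discharge `stub_hcpTubeRigidity` (e*-form) by X1 and keep
`stub_selectionFloor`, OR switch to this file and replace BOTH cores by {X1, X2, X3}. -/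

/-- X1 ⇒ the live line's rigidity core (`e*`-form), by lead c8's landed merge theorem. [folklore] -/
theorem hcpTubeRigidity_eStar_of_core
    (hCORE : ∀ a₀ h₀ : ℝ, 189 / 200 ≤ a₀ → a₀ ≤ 199 / 200 → 77 / 100 ≤ h₀ → h₀ ≤ 163 / 200 →
      (∀ a h : ℝ, 0 < a → 0 < h → hcpE a₀ h₀ ≤ hcpE a h) →
      ∀ δ : ℝ, 0 < δ → ∃ κ : ℝ, 0 < κ ∧
        ∀ Dm : Measure (EuclideanSpace ℝ (Fin 3)) → ℝ≥0∞, Measurable Dm →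
          (∀ μ : Measure (EuclideanSpace ℝ (Fin 3)), IsRootedHardCore δ μ →
            Dm μ = ENNReal.ofReal
              (min (starDefect a₀ h₀ μ)
                  (⨅ A : EuclideanSpace ℝ (Fin 3) ≃ₗᵢ[ℝ] EuclideanSpace ℝ (Fin 3),
                    ∑ p ∈ fccKissingPattern, Metric.infDist (A (a₀ • p)) (rootStar μ) ^ 2) +
                (μ {y : EuclideanSpace ℝ (Fin 3) | 11 / 10 < ‖y‖ ∧ ‖y‖ ≤ 5 / 4}).toReal)) →
          ∀ P : Measure (Measure (EuclideanSpace ℝ (Fin 3))), IsProbabilityMeasure P →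
            (∀ᵐ μ ∂P, IsRootedHardCore δ μ) → IsPointStationaryLaw P →
            (∀ᵐ μ ∂P, ∃ S : Set (EuclideanSpace ℝ (Fin 3)),
              μ = (Measure.count : Measure (EuclideanSpace ℝ (Fin 3))).restrict S ∧
              (∀ y ∈ S, SetGood S y) ∧
              ∃ s : ℤ → ℤ, IsHaggSeq s ∧
                ∃ Φ : EuclideanSpace ℝ (Fin 3) → EuclideanSpace ℝ (Fin 3),
                  Set.BijOn Φ (barlowStacking 1 (Real.sqrt (2 / 3)) s) S ∧
                  ∀ p ∈ barlowStacking 1 (Real.sqrt (2 / 3)) s, ∀ q ∈ barlowStacking 1 (Real.sqrt (2 / 3)) s,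
                    (dist p q = 1 ↔ (0 < dist (Φ p) (Φ q) ∧ dist (Φ p) (Φ q) < 6 / 5))) →
            (∀ᵐ μ ∂P, ∃ S : Set (EuclideanSpace ℝ (Fin 3)),
              μ = (Measure.count : Measure (EuclideanSpace ℝ (Fin 3))).restrict S ∧
              ∀ p ∈ S, HasSum (fun q : {q : EuclideanSpace ℝ (Fin 3) // q ∈ S ∧ q ≠ p} =>
                (deriv lennardJones (dist p q.1) / dist p q.1) • (p - q.1)) 0) →
            (∀ M : EuclideanSpace ℝ (Fin 3) →L[ℝ] EuclideanSpace ℝ (Fin 3),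
              ∫ μ, (∫ y, deriv lennardJones ‖y‖ / ‖y‖ * inner ℝ y (M y) ∂μ) ∂P = 0) →
            hcpE a₀ h₀ + κ * (∫⁻ μ, Dm μ ∂P).toReal ≤ ∫ μ, (∫ y, lennardJones ‖y‖ ∂μ) / 2 ∂P) :
    ∀ a₀ h₀ : ℝ, 189 / 200 ≤ a₀ → a₀ ≤ 199 / 200 → 77 / 100 ≤ h₀ → h₀ ≤ 163 / 200 →
      (∀ a h : ℝ, 0 < a → 0 < h → hcpE a₀ h₀ ≤ hcpE a h) →
      ∀ P : Measure (Measure E3), IsProbabilityMeasure P → PointStationary P → HcpLayered P →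
        meanRootEnergy P ≤ eStar → ∀ᵐ μ ∂P, starDefect a₀ h₀ μ = 0 :=
  fun a₀ h₀ ha₁ ha₂ hh₁ hh₂ hmin P hP hstat hHL hE =>
    Summit.AtomisticToContinuum.Crystallization.Theorems.PalmGoodLaw.RouteBetaTubeMerge.starDefect_ae_zero_of_funnelDefectFloor
      hCORE a₀ h₀ ha₁ ha₂ hh₁ hh₂ hmin P hP hstat hHL hE

/-! ## Read-backs and Disproof anchors (sorry-free) -/

/-- The crux's H3 is load-bearing (landed Negative lemma, Disproof §7): the skeleton elaborates against it. -/
example := @Summit.AtomisticToContinuum.Crystallization.Theorems.LayeredLawsSelectHcp.Negative.FccModel.layeredLawsSelectHcp_false_without_energy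

/-- H1 is redundant (landed Negative lemma, Disproof §13). -/
example := @Summit.AtomisticToContinuum.Crystallization.Theorems.LayeredLawsSelectHcp.Negative.RootedRedundant.crux_iff_without_rooted

/-- The hcp-word special case of X2 is landed on this crux (p102411). -/
example := @stub_localCongruence

end Summit.AtomisticToContinuum.Crystallization.Cruxes.LayeredLawsSelectHcp.OneFloorExactStars

end
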